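import Literature.AlgebraicGeometry.Resolution.SecantColonAnnihilator
import Literature.AlgebraicGeometry.Resolution.MacaulayficationSecantCalculus
import Literature.AlgebraicGeometry.Resolution.MacaulayficationDSequences
import HarnessLib

/-!
# Colon-secant sequences are `d`-sequences in reverse order (Kawasaki 2000, Thm. 2.9–2.10)

Topic: `Literature/AlgebraicGeometry/Resolution` (first of the "Kawasaki inputs" of Česnavičius's
Macaulayfication, [Cesnavicius2021, Prop. 3.10 (b)]: "for any secant for `M/(r₁,…,r_s)M`
sequence `r'₁,…,r'_{s'} ∈ 𝔪` with `M' = M/(r'₁,…,r'_{s'})M`, `r_s, …, r₁` is a `d`-sequence for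
`M'`" — "a special case of [Kaw00] 2.10 … one deduces it from a slightly more general [Kaw00] 2.9,
which is a consequence of the result of Schenzel"). We prove it for **colon-secant** sequences
(`SecantColonAnnihilator.lean`: `rᵢ ∈ 𝔯(M/(r₁,…,rᵢ₋₁)M)`, the consequence of Schenzel's theorem
that the printed proofs use), over any Noetherian local ring.

* `secantColonAnnihilator_le_quotient` — `𝔯(M) ⊆ 𝔯(M/(y)M)` for a secant sequence `y` of `M`.
* (from `MacaulayficationSecantCalculus.lean`: sublists of secant sequences are secant, and
  `r₁,…,rᵢ₋₁, a·b` is secant when `r₁,…,rᵢ₋₁,a` and `r₁,…,rᵢ₋₁,b` are.)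
* `IsColonSecantSequence.quotient` — colon-secant sequences stay colon-secant modulo a secant
  sequence `r'` of `M/(r₁,…,r_s)M`.
* `IsColonSecantSequence.mem_of_smul_mem_drop`, `IsColonSecantSequence.isDSequence_reverse` —
  **`r_s, …, r₁` is a `d`-sequence** (`IsDSequence`, `MacaulayficationDSequences.lean`), and
  `IsColonSecantSequence.isDSequence_reverse_quotient` — the same for `M'` as displayed above.

Proof of the main statement (induction on `s`, all modules at once): for `i < s` pass to
`M/r_sM`, for which `r₁,…,r_{s-1}` is again colon-secant; for `i = s` show by induction on `j`
that `r_s` kills no nonzero element of `(r₁,…,r_j)M`: if `m = m₀ + r_j n` with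
`m₀ ∈ (r₁,…,r_{j-1})M` and `r_s m = 0`, then `(r_s r_j) n ∈ (r₁,…,r_{j-1})M`, and since `r_s r_j`
is a parameter of `M/(r₁,…,r_{j-1})M` and `r_j ∈ 𝔯(M/(r₁,…,r_{j-1})M)`, also
`r_j n ∈ (r₁,…,r_{j-1})M`; so `m ∈ (r₁,…,r_{j-1})M` and the inductive hypothesis applies.

[cite: Kawasaki2000, Thm. 2.9, Thm. 2.10; Cesnavicius2021, Prop. 3.10 (b)]
-/

noncomputable section

open IsLocalRing Ideal Module Submodule

universe u v

namespace Literature.AlgebraicGeometry.Resolution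

variable {S : Type u} [CommRing S]

/-! ## Submodules `(x)M` in iterated quotients -/

section Bookkeeping

variable {M : Type v} [AddCommGroup M] [Module S M]

/-- `ofList` only depends on the underlying set: `(xs ++ ys) = (ys ++ xs)` as ideals. [folklore] -/
theorem ofList_append_comm (xs ys : List S) : ofList (xs ++ ys) = ofList (ys ++ xs) := by
  rw [ofList_append, ofList_append, sup_comm]

/-- `ofList` of a reversed list. [folklore] -/
theorem ofList_reverse (xs : List S) : ofList xs.reverse = ofList xs := by
  simp only [Ideal.ofList, List.mem_reverse]

/-- `(y)(M/A) = ((y)M).map (M → M/A)`. [folklore] -/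
theorem ofList_smul_top_quotient_eq_map (A : Submodule S M) (ys : List S) :
    (ofList ys • ⊤ : Submodule S (M ⧸ A)) = (ofList ys • ⊤ : Submodule S M).map A.mkQ := by
  rw [Submodule.map_smul'', Submodule.map_top, Submodule.range_mkQ]

/-- The preimage of `(y)(M/(x)M)` in `M` is `(x, y)M`. [folklore] -/
theorem comap_mkQ_ofList_smul_top (xs ys : List S) :
    (ofList ys • ⊤ : Submodule S (M ⧸ (ofList xs • ⊤ : Submodule S M))).comap
        (ofList xs • ⊤ : Submodule S M).mkQ =
      ofList (xs ++ ys) • ⊤ := by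
  rw [ofList_smul_top_quotient_eq_map, Submodule.comap_map_eq, Submodule.ker_mkQ, ofList_append,
    Submodule.sup_smul, sup_comm]

/-- `m ↦ m̄` maps `(x, y)M` onto `(y)(M/(x)M)`: membership test. [folklore] -/
theorem mkQ_mem_ofList_smul_top_iff (xs ys : List S) (m : M) :
    (ofList xs • ⊤ : Submodule S M).mkQ m ∈
        (ofList ys • ⊤ : Submodule S (M ⧸ (ofList xs • ⊤ : Submodule S M))) ↔
      m ∈ (ofList (xs ++ ys) • ⊤ : Submodule S M) := by
  rw [← Submodule.mem_comap, comap_mkQ_ofList_smul_top]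

/-- The image of `(x, y)M` in `M/(x)M` is `(y)(M/(x)M)`. [folklore] -/
theorem map_mkQ_ofList_append_smul_top (xs ys : List S) :
    (ofList (xs ++ ys) • ⊤ : Submodule S M).map (ofList xs • ⊤ : Submodule S M).mkQ =
      ofList ys • ⊤ := by
  rw [ofList_append, Submodule.sup_smul, Submodule.map_sup, Submodule.mkQ_map_self, bot_sup_eq,
    ← ofList_smul_top_quotient_eq_map]

/-- **`(M/(x)M)/(y)(M/(x)M) ≅ M/(x, y)M`.** [folklore] -/
def quotQuotOfListEquiv (xs ys : List S) :
    ((M ⧸ (ofList xs • ⊤ : Submodule S M)) ⧸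
        (ofList ys • ⊤ : Submodule S (M ⧸ (ofList xs • ⊤ : Submodule S M)))) ≃ₗ[S]
      M ⧸ (ofList (xs ++ ys) • ⊤ : Submodule S M) :=
  (Submodule.quotEquivOfEq _ _ (map_mkQ_ofList_append_smul_top xs ys).symm).trans
    (Submodule.quotientQuotientEquivQuotient (ofList xs • ⊤ : Submodule S M)
      (ofList (xs ++ ys) • ⊤) (Submodule.smul_mono_left (by
        rw [ofList_append]; exact le_sup_left)))

end Bookkeeping

/-! ## `𝔯(M)` under isomorphisms and secant quotients -/

section Annihilator

variable [IsLocalRing S]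
variable {M : Type v} [AddCommGroup M] [Module S M] {M₂ : Type v} [AddCommGroup M₂] [Module S M₂]

/-- `𝔯` is monotone along linear isomorphisms (one inclusion). [folklore] -/
theorem secantColonAnnihilator_le_of_equiv (e : M ≃ₗ[S] M₂) :
    secantColonAnnihilator S M ≤ secantColonAnnihilator S M₂ := by
  intro c hc rs hrs hmem i hi m hm
  have hrs' : IsSecantSequence M rs := (isSecantSequence_congr e rs).mpr hrs
  have key : ∀ (I : Ideal S) (x : M₂), x ∈ (I • ⊤ : Submodule S M₂) ↔
      e.symm x ∈ (I • ⊤ : Submodule S M) := by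
    intro I x
    constructor
    · intro hx
      have := Submodule.mem_map_of_mem (f := e.symm.toLinearMap) hx
      rwa [Submodule.map_smul'', Submodule.map_top, LinearEquiv.range] at this
    · intro hx
      have := Submodule.mem_map_of_mem (f := e.toLinearMap) hx
      rwa [Submodule.map_smul'', Submodule.map_top, LinearEquiv.range, LinearEquiv.coe_coe,
        LinearEquiv.apply_symm_apply] at this
  rw [key, LinearEquiv.map_smul]
  exact hc hrs' hmem hi (by rw [← LinearEquiv.map_smul, ← key]; exact hm)

/-- `𝔯` is invariant under linear isomorphisms. [folklore] -/
theorem secantColonAnnihilator_congr (e : M ≃ₗ[S] M₂) :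
    secantColonAnnihilator S M = secantColonAnnihilator S M₂ :=
  le_antisymm (secantColonAnnihilator_le_of_equiv e) (secantColonAnnihilator_le_of_equiv e.symm)

/-- `𝔯(M/A) = 𝔯(M/B)` for equal submodules `A = B`. [folklore] -/
theorem secantColonAnnihilator_quotient_congr {A B : Submodule S M} (h : A = B) :
    secantColonAnnihilator S (M ⧸ A) = secantColonAnnihilator S (M ⧸ B) :=
  secantColonAnnihilator_congr (Submodule.quotEquivOfEq A B h)

/-- **`𝔯(M) ⊆ 𝔯(M/(y)M)` for a secant sequence `y` of `M` in `𝔪`**: the secant sequences `z` of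
`M/(y)M` are those with `y, z` secant for `M`, and the colon modules of `z` on `M/(y)M` are colon
modules of `y, z` on `M`. [folklore] -/
theorem secantColonAnnihilator_le_quotient {ys : List S} (hys : IsSecantSequence M ys)
    (hmem : ∀ y ∈ ys, y ∈ maximalIdeal S) :
    secantColonAnnihilator S M ≤
      secantColonAnnihilator S (M ⧸ (ofList ys • ⊤ : Submodule S M)) := by
  intro c hc zs hzs hzmem i hi mbar hm
  induction mbar using Submodule.Quotient.induction_on with
  | H m =>
    have hws : IsSecantSequence M (ys ++ zs) := (isSecantSequence_append_iff ys zs).mpr ⟨hys, hzs⟩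
    have hwmem : ∀ w ∈ ys ++ zs, w ∈ maximalIdeal S := by
      intro w hw
      rcases List.mem_append.mp hw with hw | hw
      · exact hmem w hw
      · exact hzmem w hw
    have hj : ys.length + i < (ys ++ zs).length := by rw [List.length_append]; omega
    have hget : (ys ++ zs)[ys.length + i] = zs[i] := by
      rw [List.getElem_append_right (by omega)]
      simp
    have htake : (ys ++ zs).take (ys.length + i) = ys ++ zs.take i := by
      rw [List.take_append, List.take_of_length_le (by omega), Nat.add_sub_cancel_left]
    -- the hypothesis, pulled back to `M`
    have hm' : (ys ++ zs)[ys.length + i] • m ∈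
        (ofList ((ys ++ zs).take (ys.length + i)) • ⊤ : Submodule S M) := by
      rw [hget, htake, ← mkQ_mem_ofList_smul_top_iff, map_smul]
      exact hm
    have := hc hws hwmem hj hm'
    rw [htake, ← mkQ_mem_ofList_smul_top_iff, map_smul] at this
    exact this

end Annihilator

/-! ## Closure properties of colon-secant sequences -/

section Closure

variable [IsNoetherianRing S] [IsLocalRing S]
variable {M : Type v} [AddCommGroup M] [Module S M] [Module.Finite S M]

omit [IsNoetherianRing S] [Module.Finite S M] in
/-- Initial segments of colon-secant sequences are colon-secant. [folklore] -/
theorem IsColonSecantSequence.take {rs : List S} (h : IsColonSecantSequence M rs) (j : ℕ) :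
    IsColonSecantSequence M (rs.take j) := by
  refine ⟨h.1.take j, fun r hr => h.2.1 r (List.mem_of_mem_take hr), fun i hi => ?_⟩
  have hi' : i < rs.length := lt_of_lt_of_le hi (List.length_take_le' j rs)
  have hij : i ≤ j := by
    have := List.length_take_le j rs
    omega
  rw [List.getElem_take, List.take_take, Nat.min_eq_left hij]
  exact h.2.2 i hi'

/-- **Colon-secant modulo a secant sequence of the quotient** (the setting of
[Cesnavicius2021, Prop. 3.10]): if `r₁,…,r_s` is colon-secant for `M` and `r'` is a secant
sequence of `M/(r₁,…,r_s)M` in `𝔪`, then `r₁,…,r_s` is colon-secant for `M' = M/(r')M`.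
[cite: Cesnavicius2021, Prop. 3.10] -/
theorem IsColonSecantSequence.quotient {rs rs' : List S}
    (h : IsColonSecantSequence M rs)
    (hrs' : IsSecantSequence (M ⧸ (ofList rs • ⊤ : Submodule S M)) rs')
    (hmem' : ∀ r ∈ rs', r ∈ maximalIdeal S) :
    IsColonSecantSequence (M ⧸ (ofList rs' • ⊤ : Submodule S M)) rs := by
  have hall : IsSecantSequence M (rs ++ rs') := (isSecantSequence_append_iff rs rs').mpr ⟨h.1, hrs'⟩
  have hallmem : ∀ r ∈ rs ++ rs', r ∈ maximalIdeal S := by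
    intro r hr
    rcases List.mem_append.mp hr with hr | hr
    · exact h.2.1 r hr
    · exact hmem' r hr
  have hperm : IsSecantSequence M (rs' ++ rs) := hall.of_perm List.perm_append_comm hallmem
  refine ⟨((isSecantSequence_append_iff rs' rs).mp hperm).2, h.2.1, fun t ht => ?_⟩
  -- `rs[t] ∈ 𝔯(M/(rs.take t)M) ⊆ 𝔯((M/(rs.take t)M)/(rs')…) = 𝔯(M/(rs.take t ++ rs')M)`
  have h1 := h.2.2 t ht
  have hsub : IsSecantSequence M (rs.take t ++ rs') :=
    hall.sublist ((List.take_sublist t rs).append (List.Sublist.refl rs')) hallmem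
  have hsec' : IsSecantSequence (M ⧸ (ofList (rs.take t) • ⊤ : Submodule S M)) rs' :=
    ((isSecantSequence_append_iff (rs.take t) rs').mp hsub).2
  have h2 := secantColonAnnihilator_le_quotient hsec' hmem' h1
  rw [secantColonAnnihilator_congr (quotQuotOfListEquiv (rs.take t) rs'),
    secantColonAnnihilator_quotient_congr (M := M)
      (show (ofList (rs.take t ++ rs') • ⊤ : Submodule S M) = ofList (rs' ++ rs.take t) • ⊤ by
        rw [ofList_append_comm]),
    ← secantColonAnnihilator_congr (quotQuotOfListEquiv rs' (rs.take t))] at h2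
  exact h2

/-- **Dropping the last element**: if `r₁,…,r_k, r` is colon-secant for `M` then `r₁,…,r_k` is
colon-secant for `M/rM`. [folklore] -/
theorem IsColonSecantSequence.of_append_singleton {xs : List S} {r : S}
    (h : IsColonSecantSequence M (xs ++ [r])) :
    IsColonSecantSequence (M ⧸ (ofList [r] • ⊤ : Submodule S M)) xs := by
  have hmem := h.2.1
  have hperm : IsSecantSequence M ([r] ++ xs) := h.1.of_perm List.perm_append_comm hmem
  refine ⟨((isSecantSequence_append_iff [r] xs).mp hperm).2,
    fun x hx => hmem x (List.mem_append_left _ hx), fun t ht => ?_⟩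
  have ht' : t < (xs ++ [r]).length := by rw [List.length_append]; omega
  have h1 := h.2.2 t ht'
  rw [List.getElem_append_left ht, List.take_append_of_le_length ht.le] at h1
  -- `[r]` is secant for `M/(xs.take t)M`
  have hsub : IsSecantSequence M (xs.take t ++ [r]) :=
    h.1.sublist ((List.take_sublist t xs).append (List.Sublist.refl [r])) hmem
  have hsec' : IsSecantSequence (M ⧸ (ofList (xs.take t) • ⊤ : Submodule S M)) [r] :=
    ((isSecantSequence_append_iff (xs.take t) [r]).mp hsub).2
  have h2 := secantColonAnnihilator_le_quotient hsec'
    (fun x hx => hmem x (by rw [List.mem_singleton.mp hx]; simp)) h1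
  rw [secantColonAnnihilator_congr (quotQuotOfListEquiv (xs.take t) [r]),
    secantColonAnnihilator_quotient_congr (M := M)
      (show (ofList (xs.take t ++ [r]) • ⊤ : Submodule S M) = ofList ([r] ++ xs.take t) • ⊤ by
        rw [ofList_append_comm]),
    ← secantColonAnnihilator_congr (quotQuotOfListEquiv [r] (xs.take t))] at h2
  exact h2

end Closure

/-! ## The `d`-sequence property -/

section DSequence

variable [IsNoetherianRing S] [IsLocalRing S]

/-- **Main lemma** (induction on the length, all modules at once): for a colon-secant sequence
`r₁,…,r_s` of `M`, every `i`, and `m ∈ (r₁,…,r_s)M` with `rᵢ m ∈ (r_{i+1},…,r_s)M`, already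
`m ∈ (r_{i+1},…,r_s)M` — i.e. `r_s,…,r₁` is a `d`-sequence. [cite: Kawasaki2000, Thm. 2.10] -/
theorem IsColonSecantSequence.mem_of_smul_mem_drop :
    ∀ (s : ℕ) {M : Type v} [AddCommGroup M] [Module S M] [Module.Finite S M] {rs : List S},
      IsColonSecantSequence M rs → rs.length = s →
        ∀ {i : ℕ} (hi : i < rs.length) {m : M}, m ∈ (ofList rs • ⊤ : Submodule S M) →
          rs[i] • m ∈ (ofList (rs.drop (i + 1)) • ⊤ : Submodule S M) →
            m ∈ (ofList (rs.drop (i + 1)) • ⊤ : Submodule S M) := by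
  intro s
  induction s with
  | zero =>
    intro M _ _ _ rs _ hlen i hi
    rw [hlen] at hi
    exact absurd hi (Nat.not_lt_zero i)
  | succ k ih =>
    intro M _ _ _ rs h hlen i hi m hm hrm
    have hk : k < rs.length := by omega
    -- `rs = xs ++ [r]`
    set xs := rs.take k with hxs
    set r := rs[k] with hr
    have hrs : rs = xs ++ [r] := by
      conv_lhs => rw [← List.take_length (l := rs), hlen, List.take_succ_eq_append_getElem hk]
    have hxlen : xs.length = k := by rw [hxs, List.length_take, Nat.min_eq_left hk.le]
    have hmem := h.2.1
    rcases Nat.lt_succ_iff_lt_or_eq.mp (hlen ▸ hi : i < k + 1) with hlt | heq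
    · -- Case `i < k`: pass to `M̄ = M/rM`, for which `xs` is colon-secant
      have h' : IsColonSecantSequence (M ⧸ (ofList [r] • ⊤ : Submodule S M)) xs :=
        IsColonSecantSequence.of_append_singleton (hrs ▸ h)
      have hi' : i < xs.length := by rw [hxlen]; exact hlt
      have hget : rs[i] = xs[i] := by
        simp only [hrs]; rw [List.getElem_append_left hi']
      -- `(rs.drop (i+1))M = ([r] ++ xs.drop (i+1))M`
      have hdrop : (ofList (rs.drop (i + 1)) • ⊤ : Submodule S M) =
          ofList ([r] ++ xs.drop (i + 1)) • ⊤ := by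
        rw [hrs, List.drop_append_of_le_length (by omega), ofList_append_comm]
      have hall : (ofList rs • ⊤ : Submodule S M) = ofList ([r] ++ xs) • ⊤ := by
        rw [hrs, ofList_append_comm]
      have key := ih h' hxlen hi' (m := (ofList [r] • ⊤ : Submodule S M).mkQ m)
        ((mkQ_mem_ofList_smul_top_iff [r] xs m).mpr (hall ▸ hm))
        (by
          rw [← map_smul, mkQ_mem_ofList_smul_top_iff, ← hget, ← hdrop]
          exact hrm)
      rw [mkQ_mem_ofList_smul_top_iff, ← hdrop] at key
      exact key
    · -- Case `i = k`: `r` kills no nonzero element of `(rs)M`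
      subst heq
      have hdrop : rs.drop (i + 1) = [] := List.drop_of_length_le (by omega)
      simp only [hdrop, ofList_nil, Submodule.bot_smul, Submodule.mem_bot] at hrm ⊢
      rw [← hr] at hrm
      -- `Z(j)`: `r` kills no nonzero element of `(rs.take j)M`, by induction on `j ≤ k + 1`
      have Z : ∀ j, j ≤ rs.length → ∀ m : M, m ∈ (ofList (rs.take j) • ⊤ : Submodule S M) →
          r • m = 0 → m = 0 := by
        intro j
        induction j with
        | zero =>
          intro _ m hm _
          simpa [ofList_nil] using hm
        | succ j ihj =>
          intro hj m hm hrm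
          have hjk : j < rs.length := by omega
          rw [ofList_take_succ rs hjk, Submodule.sup_smul, Submodule.mem_sup] at hm
          obtain ⟨m₀, hm₀, m₁, hm₁, rfl⟩ := hm
          rw [Submodule.ideal_span_singleton_smul] at hm₁
          obtain ⟨n, -, rfl⟩ := (Submodule.mem_smul_pointwise_iff_exists _ _ _).mp hm₁
          -- `(r * rs[j]) • n ∈ (rs.take j)M`
          have hprod : (r * rs[j]) • n ∈ (ofList (rs.take j) • ⊤ : Submodule S M) := by
            have e : (r * rs[j]) • n = r • (m₀ + rs[j] • n) - r • m₀ := by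
              rw [smul_add, mul_smul]; abel
            rw [e, hrm, zero_sub]
            exact Submodule.neg_mem _ (Submodule.smul_mem _ r hm₀)
          -- `[r * rs[j]]` is secant for `N_j = M/(rs.take j)M`
          have hsecj : IsSecantSequence M (rs.take j ++ [rs[j]]) := by
            rw [← List.take_succ_eq_append_getElem hjk]; exact h.1.take (j + 1)
          have hseck : IsSecantSequence M (rs.take j ++ [r]) := by
            refine h.1.sublist ?_ hmem
            rcases Nat.lt_or_ge j xs.length with hjlt | hjge
            · -- `j < k`: `rs.take j ++ [r]` is a sublist of `rs = xs ++ [r]`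
              have hsl : (rs.take j).Sublist xs := by
                rw [hxs, show rs.take j = (rs.take i).take j by
                  rw [List.take_take, Nat.min_eq_left (by omega)]]
                exact List.take_sublist j _
              conv_rhs => rw [hrs]
              exact hsl.append (List.Sublist.refl [r])
            · -- `j = k`
              have hjeq : j = i := by omega
              rw [hjeq, ← hxs, ← hrs]
          have hsecN : IsSecantSequence (M ⧸ (ofList (rs.take j) • ⊤ : Submodule S M))
              [r * rs[j]] :=
            ((isSecantSequence_append_iff (rs.take j) [r * rs[j]]).mp (hseck.append_mul hsecj)).2
          -- apply `rs[j] ∈ 𝔯(N_j)` to the sequence `[r * rs[j]]`, index `0`, element `n̄`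
          have h𝔯 := h.2.2 j hjk
          have hn : rs[j] • (ofList (rs.take j) • ⊤ : Submodule S M).mkQ n ∈
              (ofList ([r * rs[j]].take 0) • ⊤ :
                Submodule S (M ⧸ (ofList (rs.take j) • ⊤ : Submodule S M))) := by
            refine h𝔯 hsecN (fun x hx => ?_) (i := 0) (by simp) ?_
            · rw [List.mem_singleton.mp hx]
              exact Ideal.mul_mem_left _ _ (hmem _ (List.getElem_mem hjk))
            · rw [List.take_zero, ofList_nil, Submodule.bot_smul, Submodule.mem_bot,
                List.getElem_cons_zero, ← map_smul, Submodule.mkQ_apply,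
                Submodule.Quotient.mk_eq_zero]
              exact hprod
          rw [List.take_zero, ofList_nil, Submodule.bot_smul, Submodule.mem_bot, ← map_smul,
            Submodule.mkQ_apply, Submodule.Quotient.mk_eq_zero] at hn
          -- so `m = m₀ + rs[j] • n ∈ (rs.take j)M`, and `Z(j)` applies
          exact ihj (by omega) _ (Submodule.add_mem _ hm₀ hn) hrm
      have hmk : m ∈ (ofList (rs.take (i + 1)) • ⊤ : Submodule S M) := by
        rwa [← hlen, List.take_length]
      exact Z (i + 1) hlen.ge m hmk hrm

variable {M : Type v} [AddCommGroup M] [Module S M] [Module.Finite S M]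

/-- **Colon-secant sequences are `d`-sequences in reverse order** ([Kawasaki2000, Thm. 2.10] for
`p`-standard sequences; [Cesnavicius2021, Prop. 3.10 (b)] for CM-secant sequences, case `r' = ∅`).
[cite: Kawasaki2000, Thm. 2.10] -/
theorem IsColonSecantSequence.isDSequence_reverse {rs : List S} (h : IsColonSecantSequence M rs) :
    IsDSequence M rs.reverse := by
  refine ⟨fun a ha m hm hrm => ?_⟩
  have ha' : a < rs.length := by simpa using ha
  have hi' : rs.length - 1 - a < rs.length := by omega
  have hget : rs.reverse[a] = rs[rs.length - 1 - a] := by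
    rw [List.getElem_reverse]
  have htake : (ofList (rs.reverse.take a) • ⊤ : Submodule S M) =
      ofList (rs.drop (rs.length - 1 - a + 1)) • ⊤ := by
    rw [List.take_reverse, ofList_reverse, show rs.length - 1 - a + 1 = rs.length - a by omega]
  rw [ofList_reverse] at hm
  rw [hget, htake] at hrm
  rw [htake]
  exact IsColonSecantSequence.mem_of_smul_mem_drop rs.length h rfl hi' hm hrm

/-- **Kawasaki's input (b)** [Cesnavicius2021, Prop. 3.10 (b)] in colon form: for a colon-secant
sequence `r₁,…,r_s` of `M` and any secant sequence `r'₁,…,r'_{s'} ∈ 𝔪` of `M/(r₁,…,r_s)M`, with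
`M' = M/(r'₁,…,r'_{s'})M`, the reversed sequence `r_s, …, r₁` is a `d`-sequence for `M'`.
[cite: Cesnavicius2021, Prop. 3.10 (b); Kawasaki2000, Thm. 2.10] -/
theorem IsColonSecantSequence.isDSequence_reverse_quotient {rs rs' : List S}
    (h : IsColonSecantSequence M rs)
    (hrs' : IsSecantSequence (M ⧸ (ofList rs • ⊤ : Submodule S M)) rs')
    (hmem' : ∀ r ∈ rs', r ∈ maximalIdeal S) :
    IsDSequence (M ⧸ (ofList rs' • ⊤ : Submodule S M)) rs.reverse :=
  (h.quotient hrs' hmem').isDSequence_reverse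

end DSequence

end Literature.AlgebraicGeometry.Resolution

end
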